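import Literature.MathematicalPhysics.StatisticalMechanics.Theil2006Decay
import HarnessLib

/-!
# Theil 2006: the well bound of Lemma 2.1 and the upper-bound half of Theorem 1.1 under (1)–(5)

Topic: `Literature/MathematicalPhysics/StatisticalMechanics`; companion to `Theil2006.lean`
(F. Theil, *A proof of crystallization in two dimensions*, Comm. Math. Phys. **262** (2006)
209–236) and `Theil2006Decay.lean` (Lemma 2.1 (12)). Everything here is PROVED; no named fact is
added or discharged. This is the second step towards `Theil2006_groundStateEnergy` (Theorem 1.1):
`Theil2006.lean` proves the trial-state bound `limsup_N min_y E/N ≤ -3` for *normalized* `V` that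
are bounded below on `[0, ∞)`; here we derive that lower bound from the hypotheses (1)–(5).

## Content (Theil 2006, §2.2, Lemma 2.1, the bound of type (11))

* `Theil2006.unitShell`, `norm_triPoint_of_mem_unitShell`, `sqrt_three_le_norm_triPoint`: the six
  nearest neighbours of `0` in `A₂` have norm `1`, all other non-zero lattice vectors norm `≥ √3`
  (`2` is not represented by `m² + mn + n²`).
* `Theil2006.IsNormalized.hasSum_latticePotential_dilate`, `sum_unitShell_latticePotential`: the
  dilated lattice sum (1) in `ℤ²`-labels, `∑_{ξ ≠ 0} V(r|ξ|) = 6 V(r) + ∑_{|ξ| ≥ √3} V(r|ξ|)`.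
* `Theil2006.IsAdmissible.abs_tsum_tail_le`: for `r ≥ 4/5` the second part is
  `≤ (α/30)(5/4)⁵ ∑_{ξ ∈ A₂} |ξ|⁻⁵` in absolute value, by Lemma 2.1 (12)
  (`IsAdmissible.abs_apply_le` of `Theil2006Decay.lean`; `r|ξ| ≥ (4/5)√3 > 4/3`).
* `Theil2006.exists_well_lower_bound` — **the bound of type (11)**: a universal `C ≥ 0` with
  `V(r) ≥ -1 - C α` for `r ∈ (1-α, 1+α)`, `α ≤ 1/5`, every admissible `V` (normalization (1):
  the dilated lattice sum is `≥ -6`). `Theil2006.exists_lower_bound`: hence `V ≥ -1 - C α` on all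
  of `[0, ∞)` (with (2), (4), (12)), for `0 < α ≤ 1/5`.
* `Theil2006.IsAdmissible.eventually_minEnergy_div_le` — **Theorem 1.1, upper bound, under its
  own hypotheses**: for `0 < α ≤ 1/5` and `V` satisfying (1)–(5), `∀ ε > 0, ∀ᶠ N,
  min_y E(y)/N ≤ -3 + ε`.
* `Theil2006_groundStateEnergy_of_lower_bound`: the named fact (Theorem 1.1) now follows from
  the lower bound `liminf ≥ -3` ((6) of §2.1) alone, stated as an explicit hypothesis.

The threshold `1/5` is an explicit choice made here (the paper has an unspecified small `α₀`).
The printed (11) reads "`V(r) ≥ -2` for all `r ≥ 0`", for all `α ∈ (0, α₀)` and all `V` satisfying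
(1)–(5) (accepted preprint of 26 Aug 2005, p. 6, Lemma 2.1; printed proof: "The claim follows
directly from assumptions (3), (5) and the definition of `V_*`"). The sharper `V ≥ -1 - C α`
proved here is what that argument yields; the statements below are therefore cited to
Lemma 2.1 (11) as its proof content ("of type (11)"), and the printed form itself is derived from
`exists_lower_bound` in `Theil2006RenormalizedPotential.lean` (`Theil2006.exists_neg_two_le`,
threshold `min (1/5) (1/(C+1))`), which also proves (10). The lower bound `liminf ≥ -3` (the
content of §§2–4: Lemma 2.2 = `Theil2006_minimumDistance_holds`, Proposition 2.3 =
`Theil2006_shortRangeBonds_holds`, the local rigidity and long-range estimates) remains open.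
-/

noncomputable section

open scoped BigOperators Topology
open Filter Set

namespace Literature.MathematicalPhysics.StatisticalMechanics

namespace Theil2006

/-- `∑_{ξ ∈ A₂} |ξ|⁻⁵ < ∞` (the lattice `p`-series of `Theil2006Decay` at `p = 0`, `s = -5`; the
junk term at `ξ = 0` is `0`). [folklore] -/
theorem summable_norm_triPoint_inv_pow : Summable fun k : ℤ × ℤ => ‖triPoint k‖⁻¹ ^ 5 := by
  refine (summable_norm_triPoint_sub_rpow 0 (by norm_num : (-5 : ℝ) < -2)).congr fun k => ?_
  rw [sub_zero, Real.rpow_neg (norm_nonneg _), inv_pow]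
  norm_cast

variable {α : ℝ} {V : ℝ → ℝ}

/-! ### The well is not much deeper than `-1` (Lemma 2.1 (11)-type bound) -/

/-- The six nearest neighbours of the origin in `A₂` (labels).
[cite: Theil2006, §2.3 Remark 2.5] -/
def unitShell : Finset (ℤ × ℤ) := {(1, 0), (0, 1), (-1, 0), (0, -1), (1, -1), (-1, 1)}

/-- The unit shell consists of vectors of norm `1`. [folklore] -/
theorem norm_triPoint_of_mem_unitShell {k : ℤ × ℤ} (hk : k ∈ unitShell) : ‖triPoint k‖ = 1 := by
  have h2 : ‖triPoint k‖ ^ 2 = 1 := by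
    rw [norm_triPoint_sq]
    simp only [unitShell, Finset.mem_insert, Finset.mem_singleton] at hk
    rcases hk with rfl | rfl | rfl | rfl | rfl | rfl <;> norm_num
  nlinarith [norm_nonneg (triPoint k)]

/-- The unit shell has six elements. [cite: Theil2006, §2.3 Remark 2.5] -/
theorem card_unitShell : unitShell.card = 6 := by
  simp [unitShell]

/-- Outside the origin and the unit shell the norm form is `≥ 3` (`2` is not represented by
`m² + mn + n²`). [folklore] -/
theorem three_le_normForm {k : ℤ × ℤ} (hk0 : k ≠ 0) (hk : k ∉ unitShell) :
    3 ≤ k.1 ^ 2 + k.1 * k.2 + k.2 ^ 2 := by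
  obtain ⟨m, n⟩ := k
  simp only [unitShell, Finset.mem_insert, Finset.mem_singleton, Prod.mk.injEq, not_or] at hk
  simp only [ne_eq, Prod.mk_eq_zero, not_and_or] at hk0
  dsimp only
  by_cases hm : 2 ≤ |m|
  · nlinarith [sq_nonneg (2 * n + m), sq_abs m, abs_nonneg m]
  by_cases hn : 2 ≤ |n|
  · nlinarith [sq_nonneg (2 * m + n), sq_abs n, abs_nonneg n]
  have hm' := abs_lt.1 (not_le.1 hm)
  have hn' := abs_lt.1 (not_le.1 hn)
  have hm1 : -1 ≤ m := by omega
  have hm2 : m ≤ 1 := by omega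
  have hn1 : -1 ≤ n := by omega
  have hn2 : n ≤ 1 := by omega
  interval_cases m <;> interval_cases n <;> omega

/-- Second and further shells: `|ξ| ≥ √3`. [folklore] -/
theorem sqrt_three_le_norm_triPoint {k : ℤ × ℤ} (hk0 : k ≠ 0) (hk : k ∉ unitShell) :
    √3 ≤ ‖triPoint k‖ := by
  have h : (3 : ℝ) ≤ ‖triPoint k‖ ^ 2 := by
    rw [norm_triPoint_sq]; exact_mod_cast three_le_normForm hk0 hk
  exact Real.sqrt_le_iff.2 ⟨norm_nonneg _, by nlinarith⟩

/-- Dilated lattice sums in `ℤ²`-labels: `∑_k latticePotential W k = ∑_{ξ ≠ 0} W(|ξ|)`.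
[cite: Theil2006, §1 (1)] -/
theorem hasSum_latticePotential_iff {W : ℝ → ℝ} {a : ℝ} :
    HasSum (latticePotential W) a ↔
      HasSum (fun k : {k : ℤ × ℤ // k ≠ 0} => W ‖triPoint k.1‖) a := by
  have key : latticePotential W =
      ({(0 : ℤ × ℤ)}ᶜ : Set (ℤ × ℤ)).indicator fun k => W ‖triPoint k‖ := by
    funext k
    by_cases hk : k = 0
    · simp [hk]
    · rw [latticePotential_of_ne W hk, Set.indicator_of_mem (by simpa using hk)]
  rw [key]
  exact hasSum_subtype_iff_indicator.symm

/-- For a normalized `V` and `r > 0`, `∑_k latticePotential (V(r ·)) k = latticeSum V r`.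
[cite: Theil2006, §1 (1)] -/
theorem IsNormalized.hasSum_latticePotential_dilate (hV : IsNormalized V) {r : ℝ} (hr : 0 < r) :
    HasSum (latticePotential fun s => V (r * s)) (latticeSum V r) :=
  hasSum_latticePotential_iff.2 (hV.summable r hr).hasSum

/-- The unit shell of the dilated lattice `r A₂` contributes `6 V(r)`. [cite: Theil2006, §1 (1)] -/
theorem sum_unitShell_latticePotential (V : ℝ → ℝ) (r : ℝ) :
    ∑ k ∈ unitShell, latticePotential (fun s => V (r * s)) k = 6 * V r := by
  have : ∀ k ∈ unitShell, latticePotential (fun s => V (r * s)) k = V r := fun k hk => by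
    have hk0 : k ≠ 0 := by
      rintro rfl
      have := norm_triPoint_of_mem_unitShell hk
      rw [map_zero, norm_zero] at this
      exact zero_ne_one this
    rw [latticePotential_of_ne _ hk0, norm_triPoint_of_mem_unitShell hk, mul_one]
  rw [Finset.sum_congr rfl this, Finset.sum_const, card_unitShell, nsmul_eq_mul, Nat.cast_ofNat]

/-- Beyond the unit shell the dilated potential is `O(α |ξ|⁻⁵)` as soon as `r ≥ 4/5`
(`r|ξ| ≥ (4/5)√3 > 4/3` and (12)). [cite: Theil2006, §2.2 Lemma 2.1 (12)] -/
theorem IsAdmissible.abs_latticePotential_le (hV : IsAdmissible α V) {r : ℝ} (hr : 4 / 5 ≤ r)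
    {k : ℤ × ℤ} (hk : k ∉ unitShell) :
    |latticePotential (fun s => V (r * s)) k| ≤ α / 30 * (5 / 4) ^ 5 * ‖triPoint k‖⁻¹ ^ 5 := by
  by_cases hk0 : k = 0
  · subst hk0; simp
  have h3 : (5 : ℝ) / 3 < √3 := (Real.lt_sqrt (by norm_num)).2 (by norm_num)
  have hnorm : 5 / 3 < ‖triPoint k‖ := h3.trans_le (sqrt_three_le_norm_triPoint hk0 hk)
  have harg : 4 / 3 < r * ‖triPoint k‖ := by
    nlinarith [mul_nonneg (sub_nonneg.2 hr) (sub_nonneg.2 hnorm.le)]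
  rw [latticePotential_of_ne _ hk0]
  refine (hV.abs_apply_le harg.le).trans ?_
  rw [mul_inv, mul_pow, ← mul_assoc]
  have hα := hV.alpha_nonneg
  have h1 : r⁻¹ ≤ 5 / 4 := inv_le_of_inv_le₀ (by norm_num) (by norm_num; exact hr)
  gcongr

/-- The tail of the dilated lattice sum beyond the unit shell is `O(α)`, uniformly in
`r ≥ 4/5`. [cite: Theil2006, §2.2 Lemma 2.1] -/
theorem IsAdmissible.abs_tsum_tail_le (hV : IsAdmissible α V) {r : ℝ} (hr : 4 / 5 ≤ r) :
    |∑' k : ↥((unitShell : Set (ℤ × ℤ))ᶜ), latticePotential (fun s => V (r * s)) k| ≤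
      α / 30 * (5 / 4) ^ 5 * ∑' k : ℤ × ℤ, ‖triPoint k‖⁻¹ ^ 5 := by
  set T : Set (ℤ × ℤ) := (unitShell : Set (ℤ × ℤ))ᶜ with hT
  set c : ℝ := α / 30 * (5 / 4) ^ 5 with hc
  set W : ℝ → ℝ := fun s => V (r * s) with hW
  have hs : Summable (latticePotential W) :=
    (hV.hasSum_latticePotential_dilate (by linarith)).summable
  have hsT : Summable fun k : T => latticePotential W k := hs.subtype T
  have hg : Summable fun k : ℤ × ℤ => c * ‖triPoint k‖⁻¹ ^ 5 :=
    summable_norm_triPoint_inv_pow.mul_left c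
  have hgT : Summable fun k : T => c * ‖triPoint k‖⁻¹ ^ 5 := hg.subtype T
  have hc0 : 0 ≤ c := by have := hV.alpha_nonneg; positivity
  have h1 : ‖∑' k : T, latticePotential W k‖ ≤ ∑' k : T, ‖latticePotential W k‖ :=
    norm_tsum_le_tsum_norm hsT.norm
  simp only [Real.norm_eq_abs] at h1
  have h2 : ∑' k : T, |latticePotential W k| ≤ ∑' k : T, c * ‖triPoint k‖⁻¹ ^ 5 :=
    hsT.abs.tsum_le_tsum (fun k => hV.abs_latticePotential_le hr k.2) hgT
  have h3 : ∑' k : T, c * ‖triPoint k‖⁻¹ ^ 5 ≤ ∑' k : ℤ × ℤ, c * ‖triPoint k‖⁻¹ ^ 5 :=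
    Summable.tsum_subtype_le (fun k : ℤ × ℤ => c * ‖triPoint k‖⁻¹ ^ 5) T
      (fun k => by positivity) hg
  have h4 : ∑' k : ℤ × ℤ, c * ‖triPoint k‖⁻¹ ^ 5 = c * ∑' k : ℤ × ℤ, ‖triPoint k‖⁻¹ ^ 5 :=
    tsum_mul_left
  rw [h4] at h3
  exact h1.trans (h2.trans h3)

/-- **Lemma 2.1 (11)-type bound: the well is not much deeper than `-1`.** There is a universal
constant `C ≥ 0` such that for `α ≤ 1/5` every admissible `V` satisfies `V(r) ≥ -1 - C α` for
`r ∈ (1-α, 1+α)`: by (1) the dilated lattice sum `6 V(r) + ∑_{|ξ| ≥ √3} V(r|ξ|)` is `≥ -6`, and by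
(12) its second part is `O(α)` uniformly (`r|ξ| ≥ (4/5)√3 > 4/3`). (The threshold `1/5` is an
explicit choice made here; the paper works with an unspecified small `α₀`.)
[cite: Theil2006, §2.2 Lemma 2.1 (11)] -/
theorem exists_well_lower_bound : ∃ C : ℝ, 0 ≤ C ∧ ∀ (α : ℝ) (V : ℝ → ℝ), α ≤ 1 / 5 →
    IsAdmissible α V → ∀ r ∈ Ioo (1 - α) (1 + α), -1 - C * α ≤ V r := by
  set S := ∑' k : ℤ × ℤ, ‖triPoint k‖⁻¹ ^ 5 with hS_def
  have hS : 0 ≤ S := tsum_nonneg fun k => by positivity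
  refine ⟨(5 / 4) ^ 5 * S / 180, by positivity, fun α V hα5 hV r hr => ?_⟩
  obtain ⟨hr1, hr2⟩ := hr
  have hr0 : 4 / 5 ≤ r := by linarith
  have hrpos : 0 < r := by linarith
  have hsum := hV.hasSum_latticePotential_dilate hrpos
  have h6 := hV.le_latticeSum r hrpos
  have hsplit := hsum.summable.sum_add_tsum_compl (s := unitShell)
  rw [hsum.tsum_eq, sum_unitShell_latticePotential] at hsplit
  have htail := hV.abs_tsum_tail_le hr0
  have hle := le_abs_self
    (∑' k : ↥((unitShell : Set (ℤ × ℤ))ᶜ), latticePotential (fun s => V (r * s)) k)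
  have : α / 30 * (5 / 4) ^ 5 * S = 6 * ((5 / 4) ^ 5 * S / 180 * α) := by ring
  linarith

/-- Admissible potentials are bounded below on `[0, ∞)`: `V ≥ -1 - C α` for `0 < α ≤ 1/5` with the
same universal `C`, by (2), the well bound, (4) and (12). [cite: Theil2006, §2.2 Lemma 2.1 (11)] -/
theorem exists_lower_bound : ∃ C : ℝ, 0 ≤ C ∧ ∀ (α : ℝ) (V : ℝ → ℝ), 0 < α → α ≤ 1 / 5 →
    IsAdmissible α V → ∀ r, 0 ≤ r → -1 - C * α ≤ V r := by
  obtain ⟨C, hC, hwell⟩ := exists_well_lower_bound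
  refine ⟨C, hC, fun α V hα hα5 hV r hr => ?_⟩
  have hCα : 0 ≤ C * α := by positivity
  rcases le_or_gt r (1 - α) with h₁ | h₁
  · have := hV.core r ⟨hr, h₁⟩
    have : 0 < 1 / α := by positivity
    linarith
  rcases lt_or_ge r (1 + α) with h₂ | h₂
  · exact hwell α V hα5 hV r ⟨h₁, h₂⟩
  rcases le_or_gt r (4 / 3) with h₃ | h₃
  · have := hV.well r ⟨h₂, h₃⟩
    linarith
  · have h := (abs_le.1 (hV.abs_apply_le h₃.le)).1
    have : r⁻¹ ^ 5 ≤ 1 := pow_le_one₀ (by positivity) (inv_le_one_of_one_le₀ (by linarith))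
    nlinarith

/-- **Theil 2006, Theorem 1.1 — the upper bound under its own hypotheses.** For `0 < α ≤ 1/5`,
every potential satisfying (1)–(5) has `min_y E(y)/N ≤ -3 + ε` for all large `N` (the infimum is
genuine since `V` is bounded below). The threshold `1/5` is explicit here; the paper's `α₀` is an
unspecified small constant. [cite: Theil2006, §1 Theorem 1.1 and §2.1] -/
theorem IsAdmissible.eventually_minEnergy_div_le (hα : 0 < α) (hα5 : α ≤ 1 / 5)
    (hV : IsAdmissible α V) {ε : ℝ} (hε : 0 < ε) :
    ∀ᶠ N : ℕ in atTop, minEnergy V N / N ≤ -3 + ε := by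
  obtain ⟨C, -, hlow⟩ := exists_lower_bound
  exact hV.toIsNormalized.eventually_minEnergy_div_le (hlow α V hα hα5 hV) hε



end Theil2006

open Theil2006

/-- **Theorem 1.1 reduced to its lower bound.** With the upper-bound half proved
(`IsAdmissible.eventually_minEnergy_div_le`, threshold `1/5`), the named fact
`Theil2006_groundStateEnergy` follows from the lower bound `liminf_N min_y E(y)/N ≥ -3` alone —
the "much harder direction" (6) of Theil 2006, §2.1, i.e. the content of §§2–4 of the paper
(Lemma 2.2, Proposition 2.3, the local rigidity estimate and the long-range estimate), stated here
as an explicit hypothesis in `ε`-form. [cite: Theil2006, §2.1 (6)] -/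
theorem Theil2006_groundStateEnergy_of_lower_bound
    (h : ∃ α₁ : ℝ, 0 < α₁ ∧ ∀ α : ℝ, 0 < α → α < α₁ → ∀ V : ℝ → ℝ, IsAdmissible α V →
      ∀ ε : ℝ, 0 < ε → ∀ᶠ N : ℕ in atTop, -3 - ε ≤ minEnergy V N / N) :
    Theil2006_groundStateEnergy := by
  obtain ⟨α₁, hα₁, hlow⟩ := h
  refine ⟨min α₁ (1 / 5), lt_min hα₁ (by norm_num), (min_le_right _ _).trans_lt (by norm_num),
    fun α hα hα' V hV => ?_⟩
  have hα5 : α ≤ 1 / 5 := hα'.le.trans (min_le_right _ _)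
  have hα1 : α < α₁ := hα'.trans_le (min_le_left _ _)
  rw [tendsto_order]
  constructor
  · intro a ha
    filter_upwards [hlow α hα hα1 V hV ((-3 - a) / 2) (by linarith)] with N hN
    linarith
  · intro a ha
    filter_upwards [hV.eventually_minEnergy_div_le hα hα5 (ε := (a + 3) / 2) (by linarith)]
      with N hN
    linarith

end Literature.MathematicalPhysics.StatisticalMechanics

end
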